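import Summits.HodgeConjecture.HodgeConjecture.Theses.AnchorTransport

/-!
# Route AnchorTransport — `TargetOfCruxes` (item stmt-HodgeConjecture-14224)

Glue to the route's frame statement: `Target` is, on the nose, the conjunction of the bodies of the
two cruxes `VariationalHodge` and `AnchorExistence`, so `VariationalHodge → AnchorExistence → Target`
is the pairing of the two hypotheses.  No mathematical content beyond bookkeeping.
-/

-- `Summit.HodgeConjecture.HodgeConjecture.Theorems` is the mandated namespace (single-problem summit:
-- Problem = Summit), which `linter.dupNamespace` flags on every declaration; the lakefile turns the
-- linter off for the Summits library (weak option), restated here so stand-alone elaboration is warning-free.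
set_option linter.dupNamespace false

namespace Summit.HodgeConjecture.HodgeConjecture.Theorems

/-- **Item stmt-HodgeConjecture-14224 (`TargetOfCruxes`)**: the two cruxes `VariationalHodge` and
`AnchorExistence` give the route target `Target = VariationalHodge ∧ AnchorExistence` (both bodies
inlined verbatim in the route file, so the conjunction is definitional).  The type is literally the
route decl `Summit.HodgeConjecture.HodgeConjecture.Theses.AnchorTransport.TargetOfCruxes`. -/
theorem anchorTransport_targetOfCruxes_proof :
    Summit.HodgeConjecture.HodgeConjecture.Theses.AnchorTransport.TargetOfCruxes := by
  unfold Summit.HodgeConjecture.HodgeConjecture.Theses.AnchorTransport.TargetOfCruxes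
  intro hV hAn
  exact ⟨hV, hAn⟩

end Summit.HodgeConjecture.HodgeConjecture.Theorems
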